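import Summits.NavierStokesRegularity.NavierStokesRegularity.Theorems.AdaptedFrequencyTangentFlowTransferKernelVeryWeak
import Summits.NavierStokesRegularity.NavierStokesRegularity.Theorems.AdaptedFrequencyAdaptedKernelExistsHypoelliptic
import HarnessLib

/-!
# The pointwise limit of the kernels is a.e. a smooth solution of the limit adjoint equation
# (route `AdaptedFrequency`, item `TangentFlowTransfer`, stmt-NavierStokesRegularity-10494)

Helper file (all results proved). Third step of the proof of hypothesis (B) (kernel stability)
of `tangentFlowTransfer_of_hyp`. Along adapted kernels `g_k` of `∂ₜ + w_k·∇ + Δ` on windows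
`[A_k, 0)`, `A_k → −∞` (Type-I drifts, common Gaussian upper bound) converging pointwise to `Glim`
while the drifts converge pointwise to a jointly smooth divergence-free `W`:

* `veryWeak_pointwiseLimit`: `Glim` satisfies `∫∫ Glim (∂ₜΦ + DₓΦ·W − ΔₓΦ) = 0` for every
  smooth `Φ` compactly supported in `(a, 0) × ℝ³`, `a < 0`
  (`veryWeak_of_isAdaptedBackwardKernel` + `veryWeak_limit`);
* `locallyIntegrableOn_pointwiseLimit`: `Glim` is locally integrable on every open slab
  (bounded, a.e. limit of continuous functions);
* `exists_smooth_representative`: by hypoelliptic smoothing (`stub_hypoelliptic` of the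
  `AdaptedKernelExists` line: Hörmander's theorem, proved in the tree) `Glim` agrees a.e. on
  each slab `(a, 0) × ℝ³` with a jointly smooth classical solution of `∂ₜK + W·∇K + ΔK = 0`.
-/

noncomputable section

open MeasureTheory Set Function Filter TopologicalSpace Metric
open scoped Topology ContDiff Laplacian

namespace Summit.NavierStokesRegularity.NavierStokesRegularity.Theorems

open Literature.Analysis Literature.Analysis.FluidPDE
open Summit.NavierStokesRegularity.NavierStokesRegularity.Theorems.AdaptedKernelExists.NashEntropyLastBlock

local notation "ℝ³" => EuclideanSpace ℝ (Fin 3)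

/-! ### Tools -/

/-- Time bounds of a compact set inside an open time window `(a, T) × ℝ³`. [folklore] -/
theorem time_bounds_of_compact_subset {k : Set (ℝ × ℝ³)} (hk : IsCompact k) {a T : ℝ}
    (hks : k ⊆ Ioo a T ×ˢ univ) (hne : k.Nonempty) :
    ∃ t₁ t₂ : ℝ, a < t₁ ∧ t₁ ≤ t₂ ∧ t₂ < T ∧ ∀ p ∈ k, p.1 ∈ Icc t₁ t₂ := by
  set K : Set ℝ := Prod.fst '' k with hK
  have hKc : IsCompact K := hk.image continuous_fst
  have hKsub : K ⊆ Ioo a T := by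
    rintro _ ⟨p, hp, rfl⟩
    exact (hks hp).1
  obtain ⟨p₀, hp₀⟩ := hne
  have hk₀ : p₀.1 ∈ K := ⟨p₀, hp₀, rfl⟩
  refine ⟨sInf K, sSup K, (hKsub (hKc.sInf_mem ⟨_, hk₀⟩)).1,
    (csInf_le hKc.bddBelow hk₀).trans (le_csSup hKc.bddAbove hk₀), (hKsub (hKc.sSup_mem ⟨_, hk₀⟩)).2,
    fun p hp => ⟨csInf_le hKc.bddBelow ⟨p, hp, rfl⟩, le_csSup hKc.bddAbove ⟨p, hp, rfl⟩⟩⟩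

/-- The Gaussian upper envelope below a negative time `t₂`: for `t ≤ t₂ < 0`,
`C₁ (−t)^{-3/2} e^{−‖x‖²/(C₂(−t))} ≤ C₁ (−t₂)^{-3/2}` (`C₁ ≥ 0`, `C₂ > 0`). [folklore] -/
theorem gaussian_upper_le_const {C₁ C₂ t t₂ : ℝ} (hC₁ : 0 ≤ C₁) (hC₂ : 0 < C₂) (ht : t ≤ t₂)
    (ht₂ : t₂ < 0) (x : ℝ³) :
    C₁ * ((0:ℝ) - t) ^ (-(3:ℝ) / 2) * Real.exp (-(‖x - (0 : ℝ³)‖ ^ 2) / (C₂ * ((0:ℝ) - t))) ≤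
      C₁ * ((0:ℝ) - t₂) ^ (-(3:ℝ) / 2) := by
  have h1 : ((0:ℝ) - t) ^ (-(3:ℝ) / 2) ≤ ((0:ℝ) - t₂) ^ (-(3:ℝ) / 2) :=
    Real.rpow_le_rpow_of_nonpos (by linarith) (by linarith) (by norm_num)
  have h2 : Real.exp (-(‖x - (0 : ℝ³)‖ ^ 2) / (C₂ * ((0:ℝ) - t))) ≤ 1 := by
    rw [Real.exp_le_one_iff, neg_div]
    exact neg_nonpos.2 (div_nonneg (sq_nonneg _) (mul_nonneg hC₂.le (by linarith)))
  have h3 : 0 ≤ C₁ * ((0:ℝ) - t) ^ (-(3:ℝ) / 2) := mul_nonneg hC₁ (Real.rpow_nonneg (by linarith) _)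
  calc C₁ * ((0:ℝ) - t) ^ (-(3:ℝ) / 2) * Real.exp (-(‖x - (0 : ℝ³)‖ ^ 2) / (C₂ * ((0:ℝ) - t)))
      ≤ C₁ * ((0:ℝ) - t) ^ (-(3:ℝ) / 2) * 1 := mul_le_mul_of_nonneg_left h2 h3
    _ ≤ C₁ * ((0:ℝ) - t₂) ^ (-(3:ℝ) / 2) := by rw [mul_one]; exact mul_le_mul_of_nonneg_left h1 hC₁

section Limit

variable {C₀ : ℝ} {A : ℕ → ℝ} {w : ℕ → ℝ → ℝ³ → ℝ³} {g : ℕ → ℝ → ℝ³ → ℝ} {C₁ C₂ : ℝ}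
  {W : ℝ → ℝ³ → ℝ³} {Glim : ℝ → ℝ³ → ℝ}

/-- **The pointwise limit of the kernels is a very weak solution of the limit equation.** On
every slab `(a, 0) × ℝ³`, `a < 0`: `∫∫ Glim (∂ₜΦ + DₓΦ·W − ΔₓΦ) = 0` for smooth `Φ` compactly
supported in the slab. [folklore] -/
theorem veryWeak_pointwiseLimit (hC₀ : 0 ≤ C₀) (hA : Tendsto A atTop atBot)
    (hw : ∀ k, IsSmoothSpaceTimeOn (Ico (A k) 0) (w k))
    (hdiv : ∀ k, ∀ t ∈ Ico (A k) 0, VectorCalculus.IsDivFree (w k t))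
    (hI : ∀ k, ∀ t ∈ Ioo (A k) 0, ∀ x, ‖w k t x‖ ≤ C₀ / Real.sqrt (-t))
    (hg : ∀ k, IsAdaptedBackwardKernel 1 (w k) (Ico (A k) 0) 0 0 (g k)) (hC₁ : 0 < C₁)
    (hC₂ : 0 < C₂)
    (hgb : ∀ k, ∀ t ∈ Ico (A k) 0, ∀ x, g k t x ≤ C₁ * ((0:ℝ) - t) ^ (-(3:ℝ) / 2) *
      Real.exp (-(‖x - (0 : ℝ³)‖ ^ 2) / (C₂ * ((0:ℝ) - t))))
    (hwW : ∀ t < 0, ∀ x, Tendsto (fun k => w k t x) atTop (𝓝 (W t x)))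
    (hgK : ∀ t < 0, ∀ x, Tendsto (fun k => g k t x) atTop (𝓝 (Glim t x))) {a : ℝ}
    {Φ : ℝ × ℝ³ → ℝ} (hΦ : ContDiff ℝ ∞ Φ) (hΦc : HasCompactSupport Φ)
    (hΦs : tsupport Φ ⊆ Ioo a 0 ×ˢ univ) :
    ∫ p : ℝ × ℝ³, Glim p.1 p.2 * (deriv (fun s => Φ (s, p.2)) p.1 +
        fderiv ℝ (fun y => Φ (p.1, y)) p.2 (W p.1 p.2) - 1 * (Δ (fun y => Φ (p.1, y))) p.2) = 0 := by
  -- the empty-support case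
  rcases (tsupport Φ).eq_empty_or_nonempty with hempty | hne
  · refine integral_eq_zero_of_ae (Eventually.of_forall fun p => ?_)
    have hp : p ∉ tsupport Φ := by rw [hempty]; exact fun h => h
    change Glim p.1 p.2 * _ = 0
    rw [opSlice_eq_zero_of_notMem_tsupport hp, mul_zero]
  obtain ⟨t₁, t₂, hat₁, -, ht₂, htime⟩ := time_bounds_of_tsupport_subset hΦc hΦs hne
  -- beyond `j₀` the windows contain `(a, 0)`
  obtain ⟨j₀, hj₀⟩ : ∃ j₀ : ℕ, ∀ k ≥ j₀, A k < a :=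
    eventually_atTop.1 (hA.eventually (eventually_lt_atBot a))
  have hsubI : ∀ j, Ioo a 0 ⊆ Ico (A (j + j₀)) 0 := fun j t ht =>
    ⟨(hj₀ _ (Nat.le_add_left _ _)).le.trans ht.1.le, ht.2⟩
  have hsubO : ∀ j, Ioo a 0 ⊆ Ioo (A (j + j₀)) 0 := fun j t ht =>
    ⟨(hj₀ _ (Nat.le_add_left _ _)).trans ht.1, ht.2⟩
  refine veryWeak_limit (S := Ioo a 0) isOpen_Ioo (ν := 1) (w := fun j => w (j + j₀))
    (g := fun j => g (j + j₀)) hΦ hΦc hΦs (fun j => (hw _).continuousOn.mono (prod_mono (hsubI j) Subset.rfl))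
    (fun j => (hg _).contDiffOn.continuousOn.mono (prod_mono (hsubI j) Subset.rfl))
    (M := C₁ * ((0:ℝ) - t₂) ^ (-(3:ℝ) / 2)) (Bd := C₀ / Real.sqrt ((0:ℝ) - t₂))
    (fun j p hp => ?_) (fun j p hp => ?_) (fun p hp => ?_) (fun p hp => ?_) (fun j => ?_)
  · -- sup bound of the kernels on the support
    have hpt : p.1 ∈ Ico (A (j + j₀)) 0 := hsubI j (hΦs hp).1
    rw [abs_of_pos ((hg _).pos _ hpt p.2)]
    exact (hgb _ _ hpt p.2).trans (gaussian_upper_le_const hC₁.le hC₂ (htime p hp).2 ht₂ p.2)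
  · -- drift bound on the support
    have hpt : p.1 ∈ Ioo (A (j + j₀)) 0 := hsubO j (hΦs hp).1
    refine (hI _ _ hpt p.2).trans ?_
    exact div_le_div_of_nonneg_left hC₀ (Real.sqrt_pos.2 (by linarith))
      (Real.sqrt_le_sqrt (by linarith [(htime p hp).2]))
  · exact (hgK p.1 (hΦs hp).1.2 p.2).comp (tendsto_add_atTop_nat j₀)
  · exact (hwW p.1 (hΦs hp).1.2 p.2).comp (tendsto_add_atTop_nat j₀)
  · exact veryWeak_of_isAdaptedBackwardKernel (hw _) (hdiv _) (hg _) hΦ hΦc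
      (hΦs.trans (prod_mono (hsubO j) Subset.rfl))

/-- **Local integrability of the pointwise limit** on every open slab `(a, 0) × ℝ³`: it is
bounded on compact subsets (Gaussian envelope) and an everywhere limit of continuous functions.
[folklore] -/
theorem locallyIntegrableOn_pointwiseLimit (hA : Tendsto A atTop atBot)
    (hg : ∀ k, IsAdaptedBackwardKernel 1 (w k) (Ico (A k) 0) 0 0 (g k)) (hC₁ : 0 < C₁)
    (hC₂ : 0 < C₂)
    (hgb : ∀ k, ∀ t ∈ Ico (A k) 0, ∀ x, g k t x ≤ C₁ * ((0:ℝ) - t) ^ (-(3:ℝ) / 2) *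
      Real.exp (-(‖x - (0 : ℝ³)‖ ^ 2) / (C₂ * ((0:ℝ) - t))))
    (hgK : ∀ t < 0, ∀ x, Tendsto (fun k => g k t x) atTop (𝓝 (Glim t x))) {a : ℝ} :
    LocallyIntegrableOn (fun p : ℝ × ℝ³ => Glim p.1 p.2) (Ioo a 0 ×ˢ univ) volume := by
  have hO : IsOpen (Ioo a 0 ×ˢ (univ : Set ℝ³)) := isOpen_Ioo.prod isOpen_univ
  rw [locallyIntegrableOn_iff hO.isLocallyClosed]
  intro k hks hk
  rcases k.eq_empty_or_nonempty with rfl | hne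
  · exact integrableOn_empty
  obtain ⟨t₁, t₂, hat₁, -, ht₂, htime⟩ := time_bounds_of_compact_subset hk hks hne
  obtain ⟨j₀, hj₀⟩ : ∃ j₀ : ℕ, ∀ j ≥ j₀, A j < a :=
    eventually_atTop.1 (hA.eventually (eventually_lt_atBot a))
  have hsubI : ∀ j, Ioo a 0 ⊆ Ico (A (j + j₀)) 0 := fun j t ht =>
    ⟨(hj₀ _ (Nat.le_add_left _ _)).le.trans ht.1.le, ht.2⟩
  set M : ℝ := C₁ * ((0:ℝ) - t₂) ^ (-(3:ℝ) / 2) with hM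
  -- bound on `k`
  have hbd : ∀ p ∈ k, |Glim p.1 p.2| ≤ M := by
    intro p hp
    have ht : p.1 < 0 := (hks hp).1.2
    refine le_of_tendsto ((hgK p.1 ht p.2).comp (tendsto_add_atTop_nat j₀)).abs
      (Eventually.of_forall fun j => ?_)
    have hpt : p.1 ∈ Ico (A (j + j₀)) 0 := hsubI j (hks hp).1
    simp only [Function.comp]
    rw [abs_of_pos ((hg _).pos _ hpt p.2)]
    exact (hgb _ _ hpt p.2).trans (gaussian_upper_le_const hC₁.le hC₂ (htime p hp).2 ht₂ p.2)
  -- measurability on `k`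
  have hmeas : AEStronglyMeasurable (fun p : ℝ × ℝ³ => Glim p.1 p.2) (volume.restrict k) := by
    refine aestronglyMeasurable_of_tendsto_ae atTop
      (f := fun j (p : ℝ × ℝ³) => g (j + j₀) p.1 p.2) (fun j => ?_) ?_
    · have hc : ContinuousOn (fun p : ℝ × ℝ³ => g (j + j₀) p.1 p.2) k :=
        (hg _).contDiffOn.continuousOn.mono (hks.trans (prod_mono (hsubI j) Subset.rfl))
      exact hc.aestronglyMeasurable hk.measurableSet
    · rw [ae_restrict_iff' hk.measurableSet]
      exact Eventually.of_forall fun p hp =>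
        (hgK p.1 (hks hp).1.2 p.2).comp (tendsto_add_atTop_nat j₀)
  refine Integrable.mono' (g := fun _ => M) (integrableOn_const (hs := hk.measure_lt_top.ne)) hmeas ?_
  rw [ae_restrict_iff' hk.measurableSet]
  exact Eventually.of_forall fun p hp => by rw [Real.norm_eq_abs]; exact hbd p hp

/-- **A smooth representative on each slab** (hypoelliptic smoothing, Hörmander's theorem via
`stub_hypoelliptic`): on `(a, 0) × ℝ³`, `a < 0`, the pointwise limit `Glim` agrees a.e. with a
jointly smooth classical solution `K` of `∂ₜK + W·∇K + ΔK = 0`. [folklore] -/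
theorem exists_smooth_representative (hC₀ : 0 ≤ C₀) (hA : Tendsto A atTop atBot)
    (hw : ∀ k, IsSmoothSpaceTimeOn (Ico (A k) 0) (w k))
    (hdiv : ∀ k, ∀ t ∈ Ico (A k) 0, VectorCalculus.IsDivFree (w k t))
    (hI : ∀ k, ∀ t ∈ Ioo (A k) 0, ∀ x, ‖w k t x‖ ≤ C₀ / Real.sqrt (-t))
    (hg : ∀ k, IsAdaptedBackwardKernel 1 (w k) (Ico (A k) 0) 0 0 (g k)) (hC₁ : 0 < C₁)
    (hC₂ : 0 < C₂)
    (hgb : ∀ k, ∀ t ∈ Ico (A k) 0, ∀ x, g k t x ≤ C₁ * ((0:ℝ) - t) ^ (-(3:ℝ) / 2) *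
      Real.exp (-(‖x - (0 : ℝ³)‖ ^ 2) / (C₂ * ((0:ℝ) - t))))
    (hWs : IsSmoothSpaceTimeOn (Iio 0) W) (hWdiv : ∀ t < 0, VectorCalculus.IsDivFree (W t))
    (hwW : ∀ t < 0, ∀ x, Tendsto (fun k => w k t x) atTop (𝓝 (W t x)))
    (hgK : ∀ t < 0, ∀ x, Tendsto (fun k => g k t x) atTop (𝓝 (Glim t x))) {a : ℝ} (ha : a < 0) :
    ∃ K : ℝ → ℝ³ → ℝ, IsSmoothSpaceTimeOn (Ioo a 0) K ∧
      (∀ᵐ p : ℝ × ℝ³, p ∈ Ioo a 0 ×ˢ univ → Glim p.1 p.2 = K p.1 p.2) ∧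
      ∀ t ∈ Ioo a 0, ∀ x,
        deriv (fun s => K s x) t + fderiv ℝ (K t) x (W t x) + 1 * (Δ (K t)) x = 0 :=
  stub_hypoelliptic 1 a 0 W (fun p => Glim p.1 p.2) one_pos ha
    (hWs.mono fun _ ht => ht.2) (fun t ht => hWdiv t ht.2)
    (locallyIntegrableOn_pointwiseLimit hA hg hC₁ hC₂ hgb hgK)
    (fun _ hΦ hΦc hΦs => veryWeak_pointwiseLimit hC₀ hA hw hdiv hI hg hC₁ hC₂ hgb hwW hgK hΦ hΦc hΦs)

end Limit

end Summit.NavierStokesRegularity.NavierStokesRegularity.Theorems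

end
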